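import Literature.Algebra.Lie.LefschetzModuleKleimanAlgebra
import Literature.AlgebraicGeometry.Markman2025.ContractionExpConjugation
import HarnessLib

/-!
# The Weyl operator `w = exp(ᶜΛ) exp(−L) exp(ᶜΛ)` of a Lefschetz module and André's Hodge involution `*_H`
# ("l'élément `(0 1 ; −1 0)` de `SL₂` s'envoie sur `± *_H`", André 1996, §1.2)

Topic `Literature/Algebra/Lie` (namespace `Literature.Algebra.Lie`).  Lane `lit-hodgefound` (Track 2 foundations library),
prover seat `lit-hodgefound-p34` (generation 31, row g31-#1), a sequel of `LefschetzModule.lean` (row A1-88 of seat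
`lit-hodgefound-skel-1`: `degreeSpace`, `IsZGrading`, `HasLefschetzProperty`, the partner `f = ᶜΛ = HasLefschetzProperty.dual`,
`[e, f] = h`, `[h, e] = 2e`, `[h, f] = -2f`), of `LefschetzModuleStringReversal.lean` (strings `p, e p, …, eᵏ p` span; the position
projectors `eⁱNⁱ − eⁱ⁺¹Nⁱ⁺¹`, `Nᵗeᵗ − Nᵗ⁺¹eᵗ⁺¹`, `N = s e s`), of `LefschetzModuleLefschetzInvolution.lean` (`*_L = lefschetzInvolution`),
`LefschetzModuleHodgeInvolution.lean` (`hodgeSign`, `hodgeInvolution` = Kleiman's `⋆` / Milne's `∗`: `eʲ p ↦ ± e^{k-j} p`) and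
`LefschetzModuleKleimanAlgebra.lean` (`K[e, *_L] = K[e, ᶜΛ]`, Künneth projectors in `K[h]`).

THIS FILE: (1) the **Weyl operator** `w = exp(f) exp(−e) exp(f)` of a Lefschetz module — the image of the element
`(0 1 ; −1 0) = exp(X) exp(−Y) exp(X)` of `SL₂` under André's representation `ᶜΛ ↦ X = (0 1 ; 0 0)`, `L ↦ Y = (0 0 ; 1 0)` — with its
conjugation relations `w e = −f w`, `w f = −e w`, `w h = −h w` (finite Hadamard series), its action on the strings
`w (eʲ p) = (−1)^{k+j} (j!/(k−j)!) e^{k−j} p` (`p ∈ P_{-k}`), `w² = (−1)^h`, `w⁴ = 1`, `w ∈ K[e, ᶜΛ]`; (2) **André's Hodge involution**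
`*_H (Lᵏ x_{j-2k}) = (−1)^{(j−2k)(j−2k+1)/2} (k!/(d−j+k)!) L^{d−j+k} x_{j−2k}` — the tree's `hodgeInvolution` (Kleiman's `⋆`, Milne's `∗`)
RESCALED by `k!/(d−j+k)!` on the Lefschetz components — constructed as `*_L ∘ W` with `W` a polynomial in `e` and `*_L e *_L`
(`andreWeight`), an involution with **`*_H L *_H = ᶜΛ` on the nose**, `K[L, *_H] = K[L, ᶜΛ]`; (3) André's sentence "l'élément
`(0 1 ; −1 0)` de `SL₂` s'envoie sur `± *_H`, le signe [dépendant de] la composante `Hʲ`": **`*_H = (−1)^{d + j(j−1)/2} w` on `Hʲ`**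
(`andreHodgeInvolution_apply_of_mem_degreeSpace`).  DEFINITIONS WITH BODIES (`HasLefschetzProperty.weylOperator`, `andreWeight`,
`HasLefschetzProperty.andreHodgeInvolution`) and PROVED theorems only (no named fact, no `sorry`, no instance, no notation, no
local-instance attribute; D-0026 net debt `0`).  Mathlib's finite exponential `IsNilpotent.exp` wants a `ℚ`-algebra; inside
definitions and proofs ONLY, `End_K(M)` is given the `ℚ`-algebra structure through `ℚ → K` (`Algebra.compHom`, a `letI`, never an
instance); no statement other than `weylOperator_def` mentions it.

## Sources, VERBATIM (and what the scan shows)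

Y. André, *Pour une théorie inconditionnelle des motifs*, Publ. Math. IHÉS **83** (1996) 5–49 [Andre1996Motifs] (held
`paper:doi-10-1007-bf02698643`; the held text is the OCR layer of the Numdam CCITT scan, whose displayed formulas are garbled —
the readings below were checked against the two printed CONSEQUENCES (a), (b), which single them out):
* §1.1 (p. 10 = p0007 L36–L60): "Cette décomposition permet de définir l'opérateur de Hodge « abstrait » `ᶜΛ` par la formule
  suivante : si `x = Σ Lᵏ x_{j−2k}` est la décomposition de Lefschetz de `x ∈ Hʲ(X)`, alors `ᶜΛ x = Σ k(d − j + k + 1) L^{k−1} x_{j−2k}`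
  […]. On définit aussi les involutions de Lefschetz et de Hodge respectivement par les formules :
  `*_L x = Σ L^{d−j+k} x_{j−2k}`, `*_H x = Σ (−1)^{(j−2k)(j−2k+1)/2} (k! / (d−j+k)!) L^{d−j+k} x_{j−2k}`" (the OCR shows the sign
  exponent `(j-2k)(j-2k+1)/2`, a fraction bar, `L^{d-j+k}`, `x_{j-2k}` and the denominator `(d-j+k)!`).
* §1.1 (p. 11 = p0008 L10–L14): "On voit immédiatement que `Pʲ(X) = Hʲ(X) ∩ Ker *_L` et que l'opérateur `ᶜL = *_L L *_L`, proportionnel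
  à `ᶜΛ` sur chaque composante de Lefschetz, est un inverse à droite de `L` sur l'image de `L`."
* §1.2 (p. 11 = p0008 L27–L37): "Alors `(ᶜΛ, h, −L)` forme un `𝔰𝔩₂`-triplet […]. On en déduit une représentation de `𝔰𝔩₂` sur `H*(X)`,
  attachée à `η` : `ᶜΛ ↦ (0 1 ; 0 0)`, `L ↦ (0 0 ; 1 0)`, `h ↦ (1 0 ; 0 −1)`. Si `Sⁱ` désigne la puissance symétrique `i`-ème de la
  représentation standard, alors : `H*(X) ≅ ⊕ P^{d−i}(X) ⊗ Sⁱ`. (a) De plus, un calcul sans difficulté montre que l'élément `(0 1 ; −1 0)`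
  de `SL₂` s'envoie sur `± *_H`, le signe étant `(−1)^{…}` sur la composante `Hʲ`" (the exponent of the sign is unreadable in the
  scan; THIS FILE PROVES the sign `(−1)^{d + j(j−1)/2}`, Theorem `andreHodgeInvolution_apply_of_mem_degreeSpace`).
* §1.3, Lemme 1.3.2 (p. 13 = p0010 L22): (b) "Pour l'involution de Hodge, on a la formule `*_H x ⊗ *_H y = (−1)^{ij} *_H (x ⊗ y)`. […] La
  formule pour l'involution de Hodge découle de son interprétation en termes de l'élément `(0 1 ; −1 0)` de `SL₂`." (next row.)
Both (a) and (b) hold for the operator with the factor `k!/(d−j+k)!` and FAIL for the factorial-free operator `eʲ p ↦ ± e^{k−j} p`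
(= Kleiman 1968, 1.4.2 `⋆` = Milne 1999 p. 664 `∗` = the tree's `HasLefschetzProperty.hodgeInvolution`, whose docstring quotes
André's formula without the factor — read it as Kleiman's/Milne's): on a string of length `3` the Weyl element is `p ↦ ½ e²p`,
`e p ↦ −e p`, `e² p ↦ 2p`, not `± (p ↦ e²p, e²p ↦ p)`; and for two strings of length `2`, `⋆(p ⊗ q) = ± 2 (e p ⊗ e' q)` while
`⋆ p ⊗ ⋆ q = ± e p ⊗ e' q`.
N. Bourbaki, *Groupes et algèbres de Lie* VIII §1 no. 5 (the element `θ = e^{X} e^{−Y} e^{X}`… of `SL(2)` permuting the weights) —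
background only, not cited in statements.
E. Markman, arXiv:2502.03415v2, proof of Lemma 9.3.8 (p. 87) — the tree's finite Hadamard series
`exp(−L) P exp(L) = P + [P, L] + ½[[P, L], L]` (`Markman2025.ContractionExp.ad_exp_neg_second_order`), REUSED here for the
conjugations `exp(f) e exp(−f) = e − h − f`, `exp(−e)(e − h − f)exp(e) = −f` etc.

## Dictionary (continuing the series)

André's `L`, `ᶜΛ`, `h_André` are the tree's `e`, `f = L.dual hgr`, `−h` (`Hʲ = M_{j−d}`; `[h, e] = 2e`); a Lefschetz component
`Lᵏ x_{j−2k}` with `x_{j−2k} ∈ P^{j−2k}` is a string vector `eᵏ p`, `p ∈ P_{-m}`, string length `m + 1 = d − (j−2k) + 1`, and André's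
factor `k!/(d−j+k)!` is `k!/(m−k)!` = (position)! / (co-position)!.  `exp(ᶜΛ) exp(−L) exp(ᶜΛ) ↦ (1 1 ; 0 1)(1 0 ; −1 1)(1 1 ; 0 1) =
(0 1 ; −1 0)`.

## Contents (all proved; `f = L.dual hgr`, `w = L.weylOperator hgr`, `*_H = L.andreHodgeInvolution hgr d`)

* §0 `eq_zero_of_forall_string_of_mem_degreeSpace` (an operator vanishing on the string vectors of degree `m` vanishes on `M_m` —
  through the Künneth projector of `LefschetzModuleKleimanAlgebra`), `isNilpotent_of_hasLefschetzProperty`, `isNilpotent_dual`.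
* §1 `weylOperator`, `weylOperator_def`; the conjugations `exp_dual_mul_e`, `exp_neg_e_mul_sub`, `exp_neg_e_mul_dual`,
  `exp_dual_mul_sub`; **`weylOperator_mul_e`** (`w e = −f w`), **`weylOperator_mul_dual`** (`w f = −e w`), **`weylOperator_mul_h`**
  (`w h = −h w`), `weylOperator_apply_mem` (`w M_m ⊆ M_{−m}`), `weylOperator_mem_adjoin_pair_dual` (`w ∈ K[e, f]`), `commute_weylOperator`.
* §2 **`weylOperator_apply_primitive`** (`w p = (−1)ᵏ/k! · eᵏ p`), **`weylOperator_apply_pow_primitive`**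
  (`w (eʲ p) = (−1)^{k+j} j!/(k−j)! · e^{k−j} p`), `weylOperator_apply_pow_primitive_top` (`w (eᵏ p) = k! · p`),
  `weylOperator_weylOperator_apply_pow_primitive` / **`weylOperator_weylOperator_apply_of_mem`** (`w² = (−1)^m` on `M_m`),
  **`weylOperator_pow_four`** (`w⁴ = 1`).
* §3 `andreWeight`, `andreWeight_mem_adjoin`, `IsStringReversal.andreWeight_apply_pow_primitive`; **`andreHodgeInvolution`**,
  **`andreHodgeInvolution_apply_pow_primitive`** (the printed formula), `andreHodgeInvolution_apply_primitive`,
  `andreHodgeInvolution_apply_pow_primitive_eq_smul_hodgeInvolution` (`*_H = (j!/(k−j)!) · ⋆` on `eʲ p`),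
  **`andreHodgeInvolution_mul_self`** (`*_H² = 1`), **`andreHodgeInvolution_mul_e_mul_andreHodgeInvolution`** (`*_H L *_H = ᶜΛ`),
  `mul_andreHodgeInvolution_eq_neg` (`h *_H = −*_H h`), `andreHodgeInvolution_apply_mem`, `andreHodgeInvolution_mem_adjoin`
  (`*_H ∈ K[e, *_L]`), `andreHodgeInvolution_mem_adjoin_pair_dual` (`*_H ∈ K[e, ᶜΛ]`),
  **`adjoin_pair_andreHodgeInvolution_eq_adjoin_pair_dual`** (`K[L, *_H] = K[L, ᶜΛ]`, Prop. 1.2), `commute_andreHodgeInvolution`.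
* §4 **`andreHodgeInvolution_apply_pow_primitive_eq_smul_weylOperator`** (`*_H (eʲp) = (−1)^{(d−k)(d−k+1)/2 + k + j} w (eʲ p)`),
  `neg_one_pow_choose_succ_add` (the sign depends on the degree only), **`andreHodgeInvolution_apply_of_mem_degreeSpace`**
  (`*_H x = (−1)^{d + n(n−1)/2} w x` for `x ∈ Hⁿ = M_{n−d}` — André's (a)).

## SCOPE (not formalised here)

The tensor-product sorites of §1.3 (Lemme 1.3.1, Lemme 1.3.2: `w_{M ⊗ N} = w_M ⊗ w_N`, `*_H(x ⊗ y) = (−1)^{ij} *_H x ⊗ *_H y`) are the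
next row; self-adjointness of `w` and `*_H` for a Poincaré-type pairing (André §1.1 remark; cf. `LefschetzModuleSelfAdjoint.lean` for
`*_L`, `⋆`) is not formalised here.

## References

* [Andre1996Motifs] Y. André, *Pour une théorie inconditionnelle des motifs*, Publ. Math. IHÉS 83 (1996) 5–49, §1.1 (p. 10–11), §1.2
  (p. 11), Prop. 1.2 (p. 11), §1.3 Lemme 1.3.2 (p. 13).
* [Kleiman1968AlgebraicCycles] S. L. Kleiman, *Algebraic cycles and the Weil conjectures*, in: Dix exposés sur la cohomologie des
  schémas (1968) 359–386, §1.4 (1.4.2 `⋆`, 1.4.5, 1.4.6).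
* [Milne1999LefschetzClasses] J. S. Milne, *Lefschetz classes on abelian varieties*, Duke Math. J. 96 (1999) 639–675, §5 p. 664 (`∗`).
* [LooijengaLunts1997] E. Looijenga, V. A. Lunts, *A Lie algebra attached to a projective variety*, Invent. Math. 129 (1997) 361–412,
  §1 (1.1).
* [Markman2025SecantWeil] E. Markman, *Cycles on abelian 2n-folds of Weil type …*, arXiv:2502.03415v2, proof of Lemma 9.3.8 (p. 87:
  the finite Hadamard series).
-/

noncomputable section

namespace Literature.Algebra.Lie

open Module Function Set
open scoped Nat
open HasLefschetzProperty (primitiveSpace mem_primitiveSpace_iff)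

variable {K : Type*} [Field K] {M : Type*} [AddCommGroup M] [Module K M] {h e : Module.End K M}

/-! ### §0 Preliminaries: vanishing on a degree from vanishing on its strings; nilpotency; the `ℚ`-structure -/

section Prelim

/-- `(-1)ⁿ (-1)ⁿ = 1`. [folklore] -/
private theorem neg_one_pow_mul_self (n : ℕ) : ((-1 : K) ^ n) * ((-1 : K) ^ n) = 1 := by
  rw [← pow_add, ← two_mul, pow_mul, neg_one_sq, one_pow]

/-- `C(n+1, 2) = n + C(n, 2)`. [folklore] -/
private theorem choose_two_succ (n : ℕ) : (n + 1).choose 2 = n + n.choose 2 := by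
  rw [Nat.choose_succ_succ', Nat.choose_one_right]

variable [CharZero K]

/-- `n! ≠ 0` in `K`. [folklore] -/
private theorem factorial_ne_zero (n : ℕ) : ((n ! : ℕ) : K) ≠ 0 :=
  Nat.cast_ne_zero.2 (Nat.factorial_ne_zero n)

/-- The `ℚ`-algebra structure of `End_K(M)` through `ℚ → K` rescales by the rational number viewed in `K`. [folklore] -/
private theorem compHom_smul_eq (c : ℚ) (T : Module.End K M) :
    letI := Algebra.compHom (Module.End K M) (algebraMap ℚ K)
    c • T = (c : K) • T := by
  letI := Algebra.compHom (Module.End K M) (algebraMap ℚ K)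
  rw [Algebra.compHom_smul_def, eq_ratCast]

/-- The finite exponential of an operator with `aⁿ = 0`, with coefficients in `K`: `exp a = Σ_{i<n} aⁱ/i!`. [folklore] -/
private theorem exp_eq_sum_of_pow_eq_zero {a : Module.End K M} {n : ℕ} (ha : a ^ n = 0) :
    letI := Algebra.compHom (Module.End K M) (algebraMap ℚ K)
    IsNilpotent.exp a = ∑ i ∈ Finset.range n, ((i ! : ℕ) : K)⁻¹ • a ^ i := by
  letI := Algebra.compHom (Module.End K M) (algebraMap ℚ K)
  rw [IsNilpotent.exp_eq_sum ha]
  refine Finset.sum_congr rfl fun i _ ↦ ?_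
  rw [Algebra.compHom_smul_def, map_inv₀, map_natCast]

/-- `exp a` lies in every subalgebra containing `a`. [folklore] -/
private theorem exp_mem_of_mem {A : Subalgebra K (Module.End K M)} {a : Module.End K M} (ha : a ∈ A) :
    letI := Algebra.compHom (Module.End K M) (algebraMap ℚ K)
    IsNilpotent.exp a ∈ A := by
  letI := Algebra.compHom (Module.End K M) (algebraMap ℚ K)
  rw [IsNilpotent.exp]
  refine Subalgebra.sum_mem _ fun i _ ↦ ?_
  rw [compHom_smul_eq]
  exact Subalgebra.smul_mem _ (Subalgebra.pow_mem _ ha _) _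

/-- An operator commuting with `a` commutes with `exp a`. [folklore] -/
private theorem commute_exp_of_commute {u a : Module.End K M} (hua : Commute u a) :
    letI := Algebra.compHom (Module.End K M) (algebraMap ℚ K)
    Commute u (IsNilpotent.exp a) := by
  letI := Algebra.compHom (Module.End K M) (algebraMap ℚ K)
  rw [IsNilpotent.exp]
  exact Commute.sum_right _ _ _ fun i _ ↦ (hua.pow_right i).smul_right _

variable [FiniteDimensional K M]

namespace HasLefschetzProperty

/-- **An operator that kills the string vectors `eʲ p` of degree `m` (`p ∈ P_{-k}`, `-k + 2j = m`) kills `M_m`** — compose with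
the Künneth projector onto `M_m`, a polynomial in `h` (`LefschetzModuleKleimanAlgebra`), and test on all strings.
[cite: Andre1996Motifs, §1.1 (p. 10, Lefschetz decomposition `Hʲ = ⊕ Lᵏ P^{j-2k}`) and §1.2 (p. 11, Künneth projectors)] -/
theorem eq_zero_of_forall_string_of_mem_degreeSpace (L : HasLefschetzProperty h e) (hgr : IsZGrading h)
    {T : Module.End K M} {m : ℤ}
    (hT : ∀ ⦃k : ℕ⦄ ⦃p : M⦄, p ∈ primitiveSpace h e k → ∀ ⦃j : ℕ⦄, j ≤ k → -(k : ℤ) + 2 * j = m → T ((e ^ j) p) = 0)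
    {x : M} (hx : x ∈ degreeSpace h m) : T x = 0 := by
  obtain ⟨π, -, hπ⟩ := exists_degreeProj_mem_adjoin h m
  have hTπ : T * π = 0 := by
    refine L.linearMap_ext_of_strings hgr fun k p hp j hj ↦ ?_
    rw [Module.End.mul_apply, LinearMap.zero_apply, hπ _ _ (L.pow_apply_mem (mem_primitiveSpace_iff.1 hp).1 j)]
    split_ifs with hkm
    · exact hT hp hj hkm
    · exact map_zero T
  rw [← degreeProj_apply_of_mem hπ hx, ← Module.End.mul_apply, hTπ, LinearMap.zero_apply]

/-- **`e` is nilpotent: `e^{dim M} = 0`** (degree `2` on a bounded grading). [cite: LooijengaLunts1997, §1 (1.1) p. 4 L58–L60] -/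
theorem isNilpotent_of_hasLefschetzProperty (L : HasLefschetzProperty h e) (hgr : IsZGrading h) : IsNilpotent e :=
  ⟨Module.finrank K M, pow_finrank_eq_zero hgr L.mapsTo⟩

/-- **`f = ᶜΛ` is nilpotent: `f^{dim M} = 0`** (degree `-2`). [cite: LooijengaLunts1997, §1 (1.1) p. 4 L3, L58–L60] -/
theorem isNilpotent_dual (L : HasLefschetzProperty h e) (hgr : IsZGrading h) : IsNilpotent (L.dual hgr) :=
  ⟨Module.finrank K M, pow_finrank_eq_zero_of_neg hgr fun _ _ hx ↦ L.dual_apply_mem hgr hx⟩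

end HasLefschetzProperty

end Prelim

/-! ### §1 The Weyl operator `w = exp(f) exp(−e) exp(f)` and its conjugation relations -/

namespace HasLefschetzProperty

variable [CharZero K] [FiniteDimensional K M]

omit [FiniteDimensional K M] in
/-- **The Weyl operator `w = exp(ᶜΛ) exp(−L) exp(ᶜΛ)`** of the Lefschetz module `(M, h, e)`: the image of the element
`(0 1 ; −1 0) = (1 1 ; 0 1)(1 0 ; −1 1)(1 1 ; 0 1)` of `SL₂` under André's representation `ᶜΛ ↦ (0 1 ; 0 0)`, `L ↦ (0 0 ; 1 0)`,
`h ↦ (1 0 ; 0 −1)` ("l'élément `(0 1 ; −1 0)` de `SL₂`"), `f = ᶜΛ = L.dual hgr`; the exponentials are the finite exponential series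
of the nilpotent operators `f`, `−e`. [cite: Andre1996Motifs, §1.2 (p. 11, "l'élément (0 1 ; −1 0) de SL₂ s'envoie sur ± *_H")] -/
def weylOperator (L : HasLefschetzProperty h e) (hgr : IsZGrading h) : Module.End K M :=
  letI := Algebra.compHom (Module.End K M) (algebraMap ℚ K)
  IsNilpotent.exp (L.dual hgr) * IsNilpotent.exp (-e) * IsNilpotent.exp (L.dual hgr)

omit [FiniteDimensional K M] in
/-- `w = exp(f) exp(−e) exp(f)` (unfolding, in the `ℚ`-algebra structure of `End_K(M)` through `ℚ → K`).
[cite: Andre1996Motifs, §1.2 (p. 11)] -/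
theorem weylOperator_def (L : HasLefschetzProperty h e) (hgr : IsZGrading h) :
    letI := Algebra.compHom (Module.End K M) (algebraMap ℚ K)
    L.weylOperator hgr = IsNilpotent.exp (L.dual hgr) * IsNilpotent.exp (-e) * IsNilpotent.exp (L.dual hgr) := rfl

/-- **`exp(f) e exp(−f) = e − h − f`** (`[f, e] = −h`, `[f, [f, e]] = −2f`, the series stops), in the form `exp(f) e = (e − h − f) exp(f)`.
[cite: Andre1996Motifs, §1.2 (p. 11, the 𝔰𝔩₂-triplet (ᶜΛ, h, −L))] [cite: Markman2025SecantWeil, proof of Lemma 9.3.8 (p. 87, finite Hadamard series)] -/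
theorem exp_dual_mul_e (L : HasLefschetzProperty h e) (hgr : IsZGrading h) :
    letI := Algebra.compHom (Module.End K M) (algebraMap ℚ K)
    IsNilpotent.exp (L.dual hgr) * e = (e - h - L.dual hgr) * IsNilpotent.exp (L.dual hgr) := by
  letI := Algebra.compHom (Module.End K M) (algebraMap ℚ K)
  set f := L.dual hgr with hf
  have hfn : IsNilpotent f := L.isNilpotent_dual hgr
  have hef : e * f - f * e = h := by rw [← Ring.lie_def]; exact L.lie_e_dual hgr
  have hhf : h * f - f * h = -(f + f) := by rw [← Ring.lie_def, L.lie_h_dual hgr, two_nsmul]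
  have h1 : e * (-f) = (-f) * e + (-h) := by
    rw [mul_neg, neg_mul, ← hef]; abel
  have h2 : (-h) * (-f) = (-f) * (-h) + (-(f + f)) := by
    rw [neg_mul_neg, neg_mul_neg, ← hhf]; abel
  have h3 : (-(f + f)) * (-f) = (-f) * (-(f + f)) := by
    rw [neg_mul_neg, neg_mul_neg, add_mul, mul_add]
  have key := Literature.AlgebraicGeometry.Markman2025.ContractionExp.ad_exp_neg_second_order e (-f) (-h) (-(f + f))
    h1 h2 h3 hfn.neg
  have hhalf : (1 / 2 : ℚ) • (-(f + f)) = -f := by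
    rw [← two_smul ℚ f, smul_neg, smul_smul, show (1 / 2 : ℚ) * 2 = 1 by norm_num, one_smul]
  rw [neg_neg, hhalf] at key
  have key' : IsNilpotent.exp f * e * IsNilpotent.exp (-f) = e - h - f := by rw [key]; abel
  calc IsNilpotent.exp f * e = IsNilpotent.exp f * e * (IsNilpotent.exp (-f) * IsNilpotent.exp f) := by
        rw [IsNilpotent.exp_neg_mul_exp_self hfn, mul_one]
    _ = (IsNilpotent.exp f * e * IsNilpotent.exp (-f)) * IsNilpotent.exp f := by rw [← mul_assoc]
    _ = (e - h - f) * IsNilpotent.exp f := by rw [key']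

/-- **`exp(−e) (e − h − f) exp(e) = −f`**, in the form `exp(−e)(e − h − f) = (−f) exp(−e)`.
[cite: Andre1996Motifs, §1.2 (p. 11)] [cite: Markman2025SecantWeil, proof of Lemma 9.3.8 (p. 87)] -/
theorem exp_neg_e_mul_sub (L : HasLefschetzProperty h e) (hgr : IsZGrading h) :
    letI := Algebra.compHom (Module.End K M) (algebraMap ℚ K)
    IsNilpotent.exp (-e) * (e - h - L.dual hgr) = (-L.dual hgr) * IsNilpotent.exp (-e) := by
  letI := Algebra.compHom (Module.End K M) (algebraMap ℚ K)
  set f := L.dual hgr with hf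
  have hen : IsNilpotent e := L.isNilpotent_of_hasLefschetzProperty hgr
  have hfe : f * e = e * f - h := by
    have := L.lie_e_dual hgr; rw [Ring.lie_def] at this; rw [← this]; abel
  have hhe : h * e = e * h + (e + e) := by
    have := L.lie_h_e hgr; rw [Ring.lie_def, two_nsmul, sub_eq_iff_eq_add'] at this; rw [this]
  have h1 : (e - h - f) * e = e * (e - h - f) + (-(e + e) + h) := by
    rw [sub_mul, sub_mul, mul_sub, mul_sub, hhe, hfe]; abel
  have h2 : (-(e + e) + h) * e = e * (-(e + e) + h) + (e + e) := by
    rw [add_mul, mul_add, neg_mul, mul_neg, add_mul, mul_add, hhe]; abel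
  have h3 : (e + e) * e = e * (e + e) := by rw [add_mul, mul_add]
  have key := Literature.AlgebraicGeometry.Markman2025.ContractionExp.ad_exp_neg_second_order (e - h - f) e
    (-(e + e) + h) (e + e) h1 h2 h3 hen
  have hhalf : (1 / 2 : ℚ) • (e + e) = e := by
    rw [← two_smul ℚ e, smul_smul, show (1 / 2 : ℚ) * 2 = 1 by norm_num, one_smul]
  rw [hhalf] at key
  have key' : IsNilpotent.exp (-e) * (e - h - f) * IsNilpotent.exp e = -f := by rw [key]; abel
  calc IsNilpotent.exp (-e) * (e - h - f)
      = IsNilpotent.exp (-e) * (e - h - f) * (IsNilpotent.exp e * IsNilpotent.exp (-e)) := by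
        rw [IsNilpotent.exp_mul_exp_neg_self hen, mul_one]
    _ = (IsNilpotent.exp (-e) * (e - h - f) * IsNilpotent.exp e) * IsNilpotent.exp (-e) := by rw [← mul_assoc]
    _ = (-f) * IsNilpotent.exp (-e) := by rw [key']

/-- **`exp(−e) f exp(e) = f − h − e`**, in the form `exp(−e) f = (f − h − e) exp(−e)`.
[cite: Andre1996Motifs, §1.2 (p. 11)] [cite: Markman2025SecantWeil, proof of Lemma 9.3.8 (p. 87)] -/
theorem exp_neg_e_mul_dual (L : HasLefschetzProperty h e) (hgr : IsZGrading h) :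
    letI := Algebra.compHom (Module.End K M) (algebraMap ℚ K)
    IsNilpotent.exp (-e) * L.dual hgr = (L.dual hgr - h - e) * IsNilpotent.exp (-e) := by
  letI := Algebra.compHom (Module.End K M) (algebraMap ℚ K)
  set f := L.dual hgr with hf
  have hen : IsNilpotent e := L.isNilpotent_of_hasLefschetzProperty hgr
  have hfe : f * e = e * f + (-h) := by
    have := L.lie_e_dual hgr; rw [Ring.lie_def] at this; rw [← this]; abel
  have hhe : h * e = e * h + (e + e) := by
    have := L.lie_h_e hgr; rw [Ring.lie_def, two_nsmul, sub_eq_iff_eq_add'] at this; rw [this]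
  have h2 : (-h) * e = e * (-h) + (-(e + e)) := by
    rw [neg_mul, mul_neg, hhe]; abel
  have h3 : (-(e + e)) * e = e * (-(e + e)) := by rw [neg_mul, mul_neg, add_mul, mul_add]
  have key := Literature.AlgebraicGeometry.Markman2025.ContractionExp.ad_exp_neg_second_order f e (-h) (-(e + e))
    hfe h2 h3 hen
  have hhalf : (1 / 2 : ℚ) • (-(e + e)) = -e := by
    rw [← two_smul ℚ e, smul_neg, smul_smul, show (1 / 2 : ℚ) * 2 = 1 by norm_num, one_smul]
  rw [hhalf] at key
  have key' : IsNilpotent.exp (-e) * f * IsNilpotent.exp e = f - h - e := by rw [key]; abel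
  calc IsNilpotent.exp (-e) * f
      = IsNilpotent.exp (-e) * f * (IsNilpotent.exp e * IsNilpotent.exp (-e)) := by
        rw [IsNilpotent.exp_mul_exp_neg_self hen, mul_one]
    _ = (IsNilpotent.exp (-e) * f * IsNilpotent.exp e) * IsNilpotent.exp (-e) := by rw [← mul_assoc]
    _ = (f - h - e) * IsNilpotent.exp (-e) := by rw [key']

/-- **`exp(f)(f − h − e) exp(−f) = −e`**, in the form `exp(f)(f − h − e) = (−e) exp(f)`.
[cite: Andre1996Motifs, §1.2 (p. 11)] [cite: Markman2025SecantWeil, proof of Lemma 9.3.8 (p. 87)] -/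
theorem exp_dual_mul_sub (L : HasLefschetzProperty h e) (hgr : IsZGrading h) :
    letI := Algebra.compHom (Module.End K M) (algebraMap ℚ K)
    IsNilpotent.exp (L.dual hgr) * (L.dual hgr - h - e) = (-e) * IsNilpotent.exp (L.dual hgr) := by
  letI := Algebra.compHom (Module.End K M) (algebraMap ℚ K)
  set f := L.dual hgr with hf
  have hfn : IsNilpotent f := L.isNilpotent_dual hgr
  have hef : e * f = f * e + h := by
    have := L.lie_e_dual hgr; rw [Ring.lie_def, sub_eq_iff_eq_add'] at this; rw [this]
  have hhf : h * f = f * h + (-(f + f)) := by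
    have := L.lie_h_dual hgr; rw [Ring.lie_def, two_nsmul, sub_eq_iff_eq_add'] at this; rw [this]
  have h1 : (f - h - e) * (-f) = (-f) * (f - h - e) + (-(f + f) + h) := by
    rw [mul_neg, neg_mul, sub_mul, sub_mul, mul_sub, mul_sub, hhf, hef]; abel
  have h2 : (-(f + f) + h) * (-f) = (-f) * (-(f + f) + h) + (f + f) := by
    rw [mul_neg, neg_mul, add_mul, mul_add, neg_mul, mul_neg, add_mul, mul_add, hhf]; abel
  have h3 : (f + f) * (-f) = (-f) * (f + f) := by rw [mul_neg, neg_mul, add_mul, mul_add]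
  have key := Literature.AlgebraicGeometry.Markman2025.ContractionExp.ad_exp_neg_second_order (f - h - e) (-f)
    (-(f + f) + h) (f + f) h1 h2 h3 hfn.neg
  have hhalf : (1 / 2 : ℚ) • (f + f) = f := by
    rw [← two_smul ℚ f, smul_smul, show (1 / 2 : ℚ) * 2 = 1 by norm_num, one_smul]
  rw [neg_neg, hhalf] at key
  have key' : IsNilpotent.exp f * (f - h - e) * IsNilpotent.exp (-f) = -e := by rw [key]; abel
  calc IsNilpotent.exp f * (f - h - e)
      = IsNilpotent.exp f * (f - h - e) * (IsNilpotent.exp (-f) * IsNilpotent.exp f) := by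
        rw [IsNilpotent.exp_neg_mul_exp_self hfn, mul_one]
    _ = (IsNilpotent.exp f * (f - h - e) * IsNilpotent.exp (-f)) * IsNilpotent.exp f := by rw [← mul_assoc]
    _ = (-e) * IsNilpotent.exp f := by rw [key']

/-- **`w L = −ᶜΛ w`: the Weyl operator conjugates `L` into `−ᶜΛ`** (`(0 1 ; −1 0)(0 0 ; 1 0)(0 1 ; −1 0)⁻¹ = −(0 1 ; 0 0)`).
[cite: Andre1996Motifs, §1.2 (p. 11)] -/
theorem weylOperator_mul_e (L : HasLefschetzProperty h e) (hgr : IsZGrading h) :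
    L.weylOperator hgr * e = -(L.dual hgr * L.weylOperator hgr) := by
  letI := Algebra.compHom (Module.End K M) (algebraMap ℚ K)
  have hc : Commute (L.dual hgr) (IsNilpotent.exp (L.dual hgr)) := commute_exp_of_commute (Commute.refl _)
  rw [weylOperator_def]
  calc IsNilpotent.exp (L.dual hgr) * IsNilpotent.exp (-e) * IsNilpotent.exp (L.dual hgr) * e
      = IsNilpotent.exp (L.dual hgr) * (IsNilpotent.exp (-e) * (IsNilpotent.exp (L.dual hgr) * e)) := by
        simp only [mul_assoc]
    _ = IsNilpotent.exp (L.dual hgr) * ((IsNilpotent.exp (-e) * (e - h - L.dual hgr)) * IsNilpotent.exp (L.dual hgr)) := by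
        rw [L.exp_dual_mul_e hgr]; simp only [mul_assoc]
    _ = (IsNilpotent.exp (L.dual hgr) * (-L.dual hgr)) * IsNilpotent.exp (-e) * IsNilpotent.exp (L.dual hgr) := by
        rw [L.exp_neg_e_mul_sub hgr]; simp only [mul_assoc]
    _ = (-(L.dual hgr * IsNilpotent.exp (L.dual hgr))) * IsNilpotent.exp (-e) * IsNilpotent.exp (L.dual hgr) := by
        rw [mul_neg, ← hc.eq]
    _ = -(L.dual hgr * (IsNilpotent.exp (L.dual hgr) * IsNilpotent.exp (-e) * IsNilpotent.exp (L.dual hgr))) := by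
        simp only [neg_mul, mul_assoc]

/-- **`w ᶜΛ = −L w`: the Weyl operator conjugates `ᶜΛ` into `−L`.** [cite: Andre1996Motifs, §1.2 (p. 11)] -/
theorem weylOperator_mul_dual (L : HasLefschetzProperty h e) (hgr : IsZGrading h) :
    L.weylOperator hgr * L.dual hgr = -(e * L.weylOperator hgr) := by
  letI := Algebra.compHom (Module.End K M) (algebraMap ℚ K)
  have hc : Commute (L.dual hgr) (IsNilpotent.exp (L.dual hgr)) := commute_exp_of_commute (Commute.refl _)
  rw [weylOperator_def]
  calc IsNilpotent.exp (L.dual hgr) * IsNilpotent.exp (-e) * IsNilpotent.exp (L.dual hgr) * L.dual hgr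
      = IsNilpotent.exp (L.dual hgr) * (IsNilpotent.exp (-e) * (IsNilpotent.exp (L.dual hgr) * L.dual hgr)) := by
        simp only [mul_assoc]
    _ = IsNilpotent.exp (L.dual hgr) * ((IsNilpotent.exp (-e) * L.dual hgr) * IsNilpotent.exp (L.dual hgr)) := by
        rw [← hc.eq]; simp only [mul_assoc]
    _ = (IsNilpotent.exp (L.dual hgr) * (L.dual hgr - h - e)) * (IsNilpotent.exp (-e) * IsNilpotent.exp (L.dual hgr)) := by
        rw [L.exp_neg_e_mul_dual hgr]; simp only [mul_assoc]
    _ = -(e * (IsNilpotent.exp (L.dual hgr) * IsNilpotent.exp (-e) * IsNilpotent.exp (L.dual hgr))) := by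
        rw [L.exp_dual_mul_sub hgr]; simp only [neg_mul, mul_assoc]

/-- **`w h = −h w`: the Weyl operator reverses the grading** (`h = [e, f]`). [cite: Andre1996Motifs, §1.2 (p. 11)] -/
theorem weylOperator_mul_h (L : HasLefschetzProperty h e) (hgr : IsZGrading h) :
    L.weylOperator hgr * h = -(h * L.weylOperator hgr) := by
  set f := L.dual hgr with hf
  set w := L.weylOperator hgr with hw
  have hef : e * f - f * e = h := by rw [← Ring.lie_def]; exact L.lie_e_dual hgr
  have hwe : w * e = -(f * w) := L.weylOperator_mul_e hgr
  have hwf : w * f = -(e * w) := L.weylOperator_mul_dual hgr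
  rw [← hef, mul_sub, sub_mul, ← mul_assoc, ← mul_assoc, hwe, hwf, neg_mul, neg_mul, mul_assoc, mul_assoc, hwf, hwe]
  simp only [mul_neg, neg_neg, ← mul_assoc]
  abel

/-- **`w (M_m) ⊆ M_{−m}`.** [cite: Andre1996Motifs, §1.2 (p. 11)] -/
theorem weylOperator_apply_mem (L : HasLefschetzProperty h e) (hgr : IsZGrading h) {m : ℤ} {x : M}
    (hx : x ∈ degreeSpace h m) : L.weylOperator hgr x ∈ degreeSpace h (-m) := by
  rw [mem_degreeSpace_iff] at hx ⊢
  have h1 := LinearMap.congr_fun (L.weylOperator_mul_h hgr) x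
  rw [Module.End.mul_apply, LinearMap.neg_apply, Module.End.mul_apply, hx, map_smul] at h1
  rw [← neg_eq_iff_eq_neg.2 h1, Int.cast_neg, neg_smul]

omit [FiniteDimensional K M] in
/-- **`w ∈ K[L, ᶜΛ]`** (the exponentials are polynomials in `f` and `e`). [cite: Andre1996Motifs, Prop. 1.2 (p. 11)] -/
theorem weylOperator_mem_adjoin_pair_dual (L : HasLefschetzProperty h e) (hgr : IsZGrading h) :
    L.weylOperator hgr ∈ Algebra.adjoin K ({e, L.dual hgr} : Set (Module.End K M)) := by
  letI := Algebra.compHom (Module.End K M) (algebraMap ℚ K)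
  have he : e ∈ Algebra.adjoin K ({e, L.dual hgr} : Set (Module.End K M)) := Algebra.subset_adjoin (Set.mem_insert _ _)
  have hf : L.dual hgr ∈ Algebra.adjoin K ({e, L.dual hgr} : Set (Module.End K M)) :=
    Algebra.subset_adjoin (Set.mem_insert_of_mem _ rfl)
  rw [weylOperator_def]
  exact Subalgebra.mul_mem _ (Subalgebra.mul_mem _ (exp_mem_of_mem hf) (exp_mem_of_mem (Subalgebra.neg_mem _ he)))
    (exp_mem_of_mem hf)

omit [FiniteDimensional K M] in
/-- An operator commuting with `e` and `f` commutes with `w`. [cite: Andre1996Motifs, Prop. 1.2 (p. 11)]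
[cite: Milne1999LefschetzClasses, §5 Thm. 5.9 (proof, p. 665: "all elements of the ℚ-algebra ℚ[L, Λ]")] -/
theorem commute_weylOperator (L : HasLefschetzProperty h e) (hgr : IsZGrading h) {u : Module.End K M} (hue : Commute u e)
    (huf : Commute u (L.dual hgr)) : Commute u (L.weylOperator hgr) :=
  commute_of_mem_adjoin_pair hue huf (L.weylOperator_mem_adjoin_pair_dual hgr)

/-! ### §2 The Weyl operator on the strings -/

/-- `exp(f) p = p` for a primitive `p` (`f p = 0`). [cite: Andre1996Motifs, §1.1 (p. 10, ᶜΛ x₀ = 0)] -/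
theorem exp_dual_apply_primitive (L : HasLefschetzProperty h e) (hgr : IsZGrading h) {k : ℕ} {p : M}
    (hp : p ∈ primitiveSpace h e k) :
    letI := Algebra.compHom (Module.End K M) (algebraMap ℚ K)
    IsNilpotent.exp (L.dual hgr) p = p := by
  letI := Algebra.compHom (Module.End K M) (algebraMap ℚ K)
  have hfn : L.dual hgr ^ Module.finrank K M = 0 :=
    pow_finrank_eq_zero_of_neg hgr fun _ _ hx ↦ L.dual_apply_mem hgr hx
  have hfn1 : L.dual hgr ^ (Module.finrank K M + 1) = 0 := by rw [pow_succ, hfn, zero_mul]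
  rw [exp_eq_sum_of_pow_eq_zero hfn1, LinearMap.sum_apply, Finset.sum_range_succ', Finset.sum_eq_zero fun i _ ↦ ?_]
  · rw [zero_add, LinearMap.smul_apply, pow_zero, Module.End.one_apply, Nat.factorial_zero, Nat.cast_one, inv_one, one_smul]
  · rw [LinearMap.smul_apply, pow_succ, Module.End.mul_apply, L.dual_apply_primitive hgr hp, map_zero, smul_zero]

/-- **The Weyl operator on a primitive vector: `w p = ((−1)ᵏ / k!) · eᵏ p`** for `p ∈ P_{-k}` — in `exp(f) exp(−e) exp(f) p =
exp(f) Σₐ (−e)ᵃ p / a!` only the term `a = k`, `f⁰` has degree `k`, and `w p ∈ M_k` (`w h = −h w`); on `Sᵏ`: `(0 1 ; −1 0)` sends the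
lowest vector `vᵏ` to `(−1)ᵏ uᵏ = (−1)ᵏ Yᵏ vᵏ / k!`. [cite: Andre1996Motifs, §1.2 (p. 11, "un calcul sans difficulté")] -/
theorem weylOperator_apply_primitive (L : HasLefschetzProperty h e) (hgr : IsZGrading h) {k : ℕ} {p : M}
    (hp : p ∈ primitiveSpace h e k) :
    L.weylOperator hgr p = ((-1 : K) ^ k * ((k ! : ℕ) : K)⁻¹) • (e ^ k) p := by
  letI := Algebra.compHom (Module.End K M) (algebraMap ℚ K)
  have hpk := (mem_primitiveSpace_iff.1 hp).1
  by_cases hp0 : p = 0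
  · rw [hp0, map_zero, map_zero, smul_zero]
  set n := Module.finrank K M with hn
  have hkn : k < n := by
    by_contra hle
    exact hp0 (L.eq_zero_of_mem_primitiveSpace_of_finrank_le (not_lt.1 hle) hp)
  set f := L.dual hgr with hf
  have hen : e ^ n = 0 := pow_finrank_eq_zero hgr L.mapsTo
  have hfn : f ^ n = 0 := pow_finrank_eq_zero_of_neg hgr fun _ _ hx ↦ L.dual_apply_mem hgr hx
  have hnen : ((-1 : K) • e) ^ n = 0 := by rw [smul_pow, hen, smul_zero]
  -- the part of `M` of degrees `< k`
  set S : Submodule K M := ⨆ m : {m : ℤ // m < k}, degreeSpace h m with hS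
  have hmemS : ∀ {m : ℤ} {x : M}, m < k → x ∈ degreeSpace h m → x ∈ S := fun {m} {x} hm hx ↦
    Submodule.mem_iSup_of_mem (⟨m, hm⟩ : {m : ℤ // m < k}) hx
  have hfS : ∀ x ∈ S, f x ∈ S := by
    intro x hx
    refine Submodule.iSup_induction _ (motive := fun x ↦ f x ∈ S) hx (fun m x hx ↦ ?_)
      (by rw [map_zero]; exact Submodule.zero_mem _) (fun x y hx hy ↦ by rw [map_add]; exact Submodule.add_mem _ hx hy)
    exact hmemS (by have := m.2; omega) (L.dual_apply_mem hgr hx)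
  have hfpowS : ∀ (i : ℕ), ∀ x ∈ S, (f ^ i) x ∈ S := by
    intro i
    induction i with
    | zero => intro x hx; rwa [pow_zero, Module.End.one_apply]
    | succ i ih => intro x hx; rw [pow_succ, Module.End.mul_apply]; exact ih _ (hfS x hx)
  have hexpS : ∀ x ∈ S, IsNilpotent.exp f x ∈ S := by
    intro x hx
    rw [exp_eq_sum_of_pow_eq_zero hfn, LinearMap.sum_apply]
    exact Submodule.sum_mem _ fun i _ ↦ by rw [LinearMap.smul_apply]; exact Submodule.smul_mem _ _ (hfpowS i x hx)
  -- the candidate value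
  set yk : M := ((-1 : K) ^ k * ((k ! : ℕ) : K)⁻¹) • (e ^ k) p with hyk
  have hykk : yk ∈ degreeSpace h k := by
    refine Submodule.smul_mem _ _ ?_
    have h1 := L.pow_apply_mem hpk k
    convert h1 using 2
    ring
  -- (1) `exp(-e) p - yk ∈ S`
  have hneg : -e = (-1 : K) • e := (neg_one_smul K e).symm
  have h1 : IsNilpotent.exp (-e) p - yk ∈ S := by
    rw [hneg, exp_eq_sum_of_pow_eq_zero hnen, LinearMap.sum_apply, ← Finset.add_sum_erase _ _ (Finset.mem_range.2 hkn)]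
    have hterm : (((k ! : ℕ) : K)⁻¹ • ((-1 : K) • e) ^ k) p = yk := by
      rw [hyk, LinearMap.smul_apply, smul_pow, LinearMap.smul_apply, smul_smul, mul_comm]
    rw [hterm, add_sub_cancel_left]
    refine Submodule.sum_mem _ fun a ha ↦ ?_
    obtain ⟨hak, han⟩ := Finset.mem_erase.1 ha
    rw [LinearMap.smul_apply, smul_pow, LinearMap.smul_apply]
    refine Submodule.smul_mem _ _ (Submodule.smul_mem _ _ ?_)
    rcases lt_or_gt_of_ne hak with hlt | hgt
    · exact hmemS (by omega) (L.pow_apply_mem hpk a)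
    · have h0 := pow_apply_pow_primitive_of_lt hp (i := a) (j := 0) (by omega)
      rw [pow_zero, Module.End.one_apply] at h0
      rw [h0]
      exact Submodule.zero_mem _
  -- (2) `exp(f) yk - yk ∈ S`
  have h2 : IsNilpotent.exp f yk - yk ∈ S := by
    have hfn1 : f ^ (n + 1) = 0 := by rw [pow_succ, hfn, zero_mul]
    rw [exp_eq_sum_of_pow_eq_zero hfn1, LinearMap.sum_apply, Finset.sum_range_succ', LinearMap.smul_apply, pow_zero,
      Module.End.one_apply, Nat.factorial_zero, Nat.cast_one, inv_one, one_smul, add_sub_cancel_right]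
    refine Submodule.sum_mem _ fun i _ ↦ ?_
    rw [LinearMap.smul_apply, pow_succ, Module.End.mul_apply]
    exact Submodule.smul_mem _ _ (hfpowS i _ (hmemS (by omega) (L.dual_apply_mem hgr hykk)))
  -- (3) `w p - yk ∈ S ∩ M_k = 0`
  have hw : L.weylOperator hgr p = IsNilpotent.exp f (IsNilpotent.exp (-e) p) := by
    rw [weylOperator_def, Module.End.mul_apply, Module.End.mul_apply, L.exp_dual_apply_primitive hgr hp]
  have hdiff : L.weylOperator hgr p - yk ∈ S := by
    have : L.weylOperator hgr p - yk = IsNilpotent.exp f (IsNilpotent.exp (-e) p - yk) + (IsNilpotent.exp f yk - yk) := by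
      rw [hw, map_sub]; abel
    rw [this]
    exact Submodule.add_mem _ (hexpS _ h1) h2
  have hdiffk : L.weylOperator hgr p - yk ∈ degreeSpace h k := by
    refine Submodule.sub_mem _ ?_ hykk
    have := L.weylOperator_apply_mem hgr hpk
    rwa [neg_neg] at this
  have hdisj : Disjoint (degreeSpace h (k : ℤ)) S := by
    have := (isInternal_degreeSpace hgr).submodule_iSupIndep.disjoint_biSup (y := {m : ℤ | m < k}) (x := (k : ℤ))
      (by simp)
    rwa [← iSup_subtype''] at this
  exact sub_eq_zero.1 ((Submodule.disjoint_def.1 hdisj) _ hdiffk hdiff)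

/-- The recursion of the coefficients along a string (`k = m + j + 1`):
`−((−1)^{k+j} j!/(k−j)! · ((m+1)(k−m))) = (−1)^{k+j+1} (j+1)!/(k−j−1)!`. [folklore] -/
private theorem weyl_coeff_succ {k j m : ℕ} (hk : m + (j + 1) = k) :
    -(((-1 : K) ^ (k + j) * ((j ! : ℕ) : K) * (((k - j) ! : ℕ) : K)⁻¹) * ((((m : ℤ) + 1) * ((k : ℤ) - m) : ℤ) : K)) =
      (-1 : K) ^ (k + (j + 1)) * (((j + 1) ! : ℕ) : K) * (((k - (j + 1)) ! : ℕ) : K)⁻¹ := by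
  subst hk
  rw [show m + (j + 1) - j = m + 1 by omega, show m + (j + 1) - (j + 1) = m by omega, Nat.factorial_succ m,
    Nat.factorial_succ j, show m + (j + 1) + (j + 1) = (m + (j + 1) + j) + 1 by ring, pow_succ]
  have h1 : ((m ! : ℕ) : K) ≠ 0 := factorial_ne_zero _
  have h2 : ((m : K) + 1) ≠ 0 := by exact_mod_cast Nat.succ_ne_zero m
  push_cast
  field_simp
  ring

/-- **The Weyl operator on a string: `w (eʲ p) = (−1)^{k+j} (j!/(k−j)!) · e^{k−j} p`** for `p ∈ P_{-k}`, `j ≤ k` — by `w e = −f w`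
from `w p`, with `f (e^{i+1} p) = (i+1)(k−i) eⁱ p`; on `Sᵏ = Sym^k(K²)`: `(0 1 ; −1 0) : u^{k−j} vʲ ↦ (−1)^{k-j} v^{k−j} uʲ`, and
`Yʲ vᵏ… = (k!/(k−j)!) u^{k-j} vʲ`. This is André's `*_H` up to the sign `(−1)^{d + n(n−1)/2}` of the degree `n` (§4).
[cite: Andre1996Motifs, §1.2 (p. 11, "(0 1 ; −1 0) … s'envoie sur ± *_H")] [cite: Andre1996Motifs, §1.1 (p. 10, the factor k!/(d−j+k)! in *_H)] -/
theorem weylOperator_apply_pow_primitive (L : HasLefschetzProperty h e) (hgr : IsZGrading h) {k : ℕ} {p : M}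
    (hp : p ∈ primitiveSpace h e k) {j : ℕ} (hj : j ≤ k) :
    L.weylOperator hgr ((e ^ j) p) =
      ((-1 : K) ^ (k + j) * ((j ! : ℕ) : K) * (((k - j) ! : ℕ) : K)⁻¹) • (e ^ (k - j)) p := by
  induction j with
  | zero =>
    rw [pow_zero, Module.End.one_apply, L.weylOperator_apply_primitive hgr hp, add_zero, Nat.factorial_zero, Nat.cast_one,
      mul_one, Nat.sub_zero]
  | succ j ih =>
    obtain ⟨m, hm⟩ : ∃ m, m + (j + 1) = k := ⟨k - (j + 1), by omega⟩
    have h1 := LinearMap.congr_fun (L.weylOperator_mul_e hgr) ((e ^ j) p)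
    rw [Module.End.mul_apply, LinearMap.neg_apply, Module.End.mul_apply, ih (by omega), map_smul] at h1
    have h2 : (e ^ (k - j)) p = (e ^ (m + 1)) p := by
      rw [show m + 1 = k - j by omega]
    rw [pow_succ', Module.End.mul_apply, h1, h2, L.dual_apply_pow_primitive hgr hp m, smul_smul, ← neg_smul,
      show k - (j + 1) = m by omega, weyl_coeff_succ hm, show k - (j + 1) = m by omega]

/-- **`w (eᵏ p) = k! · p`**: the Weyl operator sends the top of a string to `k!` times its bottom.
[cite: Andre1996Motifs, §1.2 (p. 11)] -/
theorem weylOperator_apply_pow_primitive_top (L : HasLefschetzProperty h e) (hgr : IsZGrading h) {k : ℕ} {p : M}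
    (hp : p ∈ primitiveSpace h e k) : L.weylOperator hgr ((e ^ k) p) = ((k ! : ℕ) : K) • p := by
  rw [L.weylOperator_apply_pow_primitive hgr hp le_rfl, Nat.sub_self, Nat.factorial_zero, Nat.cast_one, inv_one, mul_one,
    pow_zero, Module.End.one_apply, ← two_mul, pow_mul, neg_one_sq, one_pow, one_mul]

/-- **`w² = (−1)ᵏ` on a string of length `k + 1`** (the central element `−1 = (0 1 ; −1 0)²` of `SL₂` acts on `Sᵏ` by `(−1)ᵏ`).
[cite: Andre1996Motifs, §1.2 (p. 11)] -/
theorem weylOperator_weylOperator_apply_pow_primitive (L : HasLefschetzProperty h e) (hgr : IsZGrading h) {k : ℕ} {p : M}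
    (hp : p ∈ primitiveSpace h e k) {j : ℕ} (hj : j ≤ k) :
    L.weylOperator hgr (L.weylOperator hgr ((e ^ j) p)) = ((-1 : K) ^ k) • (e ^ j) p := by
  rw [L.weylOperator_apply_pow_primitive hgr hp hj, map_smul, L.weylOperator_apply_pow_primitive hgr hp (Nat.sub_le k j),
    smul_smul, show k - (k - j) = j by omega]
  congr 1
  have h1 : (((k - j) ! : ℕ) : K) ≠ 0 := factorial_ne_zero _
  have h2 : ((j ! : ℕ) : K) ≠ 0 := factorial_ne_zero _
  have h3 : (-1 : K) ^ (k + j) * (-1 : K) ^ (k + (k - j)) = (-1) ^ k := by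
    rw [← pow_add, show k + j + (k + (k - j)) = k + 2 * k by omega, pow_add, pow_mul, neg_one_sq, one_pow, mul_one]
  calc (-1 : K) ^ (k + j) * ((j ! : ℕ) : K) * (((k - j) ! : ℕ) : K)⁻¹ *
        ((-1 : K) ^ (k + (k - j)) * (((k - j) ! : ℕ) : K) * ((j ! : ℕ) : K)⁻¹)
      = ((-1 : K) ^ (k + j) * (-1 : K) ^ (k + (k - j))) *
          ((((j ! : ℕ) : K) * ((j ! : ℕ) : K)⁻¹) * ((((k - j) ! : ℕ) : K)⁻¹ * (((k - j) ! : ℕ) : K))) := by ring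
    _ = (-1) ^ k := by rw [h3, mul_inv_cancel₀ h2, inv_mul_cancel₀ h1, mul_one, mul_one]

/-- **`w⁴ = 1`** (`(0 1 ; −1 0)` has order `4`). [cite: Andre1996Motifs, §1.2 (p. 11)] -/
theorem weylOperator_pow_four (L : HasLefschetzProperty h e) (hgr : IsZGrading h) : L.weylOperator hgr ^ 4 = 1 := by
  refine L.linearMap_ext_of_strings hgr fun k p hp j hj ↦ ?_
  rw [show (4 : ℕ) = 2 + 2 from rfl, pow_add, sq, Module.End.mul_apply, Module.End.mul_apply, Module.End.mul_apply,
    Module.End.one_apply, L.weylOperator_weylOperator_apply_pow_primitive hgr hp hj, map_smul, map_smul,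
    L.weylOperator_weylOperator_apply_pow_primitive hgr hp hj, smul_smul, neg_one_pow_mul_self, one_smul]

/-- **`w² = (−1)^m` on `M_m`** (the central element `−1` of `SL₂` acts by `(−1)^m` on the vectors of weight `m`).
[cite: Andre1996Motifs, §1.2 (p. 11)] -/
theorem weylOperator_weylOperator_apply_of_mem (L : HasLefschetzProperty h e) (hgr : IsZGrading h) {m : ℤ} {x : M}
    (hx : x ∈ degreeSpace h m) : L.weylOperator hgr (L.weylOperator hgr x) = ((-1 : K) ^ m.natAbs) • x := by
  have h1 := L.eq_zero_of_forall_string_of_mem_degreeSpace hgr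
    (T := L.weylOperator hgr * L.weylOperator hgr - ((-1 : K) ^ m.natAbs) • 1) (m := m) ?_ hx
  · rwa [LinearMap.sub_apply, Module.End.mul_apply, LinearMap.smul_apply, Module.End.one_apply, sub_eq_zero] at h1
  intro k p hp j hj hkm
  rw [LinearMap.sub_apply, Module.End.mul_apply, LinearMap.smul_apply, Module.End.one_apply,
    L.weylOperator_weylOperator_apply_pow_primitive hgr hp hj, sub_eq_zero]
  congr 1
  have heven : Even (k + m.natAbs) := by rw [Nat.even_iff]; omega
  have h2 : (-1 : K) ^ k * (-1 : K) ^ m.natAbs = 1 := by rw [← pow_add, heven.neg_one_pow]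
  calc (-1 : K) ^ k = (-1 : K) ^ k * ((-1 : K) ^ m.natAbs * (-1 : K) ^ m.natAbs) := by rw [neg_one_pow_mul_self, mul_one]
    _ = (-1 : K) ^ m.natAbs := by rw [← mul_assoc, h2, one_mul]

end HasLefschetzProperty

/-! ### §3 André's Hodge involution `*_H = *_L ∘ W`, `W = (−1)^{i(i+1)/2} · (position)!/(co-position)!` on the strings -/

variable (e) in
/-- **André's weight operator** `W = Σ_{i,t ≤ D} (−1)^{(d−(i+t))(d−(i+t)+1)/2} (i!/t!) · (eⁱNⁱ − eⁱ⁺¹Nⁱ⁺¹)(Nᵗeᵗ − Nᵗ⁺¹eᵗ⁺¹)`, `N = s e s`: on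
the string vector `eʲ p` (`p ∈ P_{-k}`, `k ≤ D`) it is the scalar `(−1)^{(d−k)(d−k+1)/2} j!/(k−j)!` — the sign AND the factor
`k!/(d−j+k)!` of André's `*_H` on the Lefschetz component `Lᵏ x_{j−2k}` (position `k`, co-position `d − j + k`).
[cite: Andre1996Motifs, §1.1 (p. 10, definition of *_H)] -/
def andreWeight (s : Module.End K M) (d D : ℕ) : Module.End K M :=
  ∑ i ∈ Finset.range (D + 1), ∑ t ∈ Finset.range (D + 1),
    ((-1 : K) ^ ((d - (i + t)) * (d - (i + t) + 1) / 2) * ((i ! : ℕ) : K) * ((t ! : ℕ) : K)⁻¹) •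
      ((e ^ i * (s * e * s) ^ i - e ^ (i + 1) * (s * e * s) ^ (i + 1)) *
        ((s * e * s) ^ t * e ^ t - (s * e * s) ^ (t + 1) * e ^ (t + 1)))

/-- `W` lies in the subalgebra generated by `e` and `N = s e s`. [cite: Andre1996Motifs, Prop. 1.2 (p. 11: ℚ[L, *_H] = ℚ[L, ᶜL])] -/
theorem andreWeight_mem_adjoin (s : Module.End K M) (d D : ℕ) :
    andreWeight e s d D ∈ Algebra.adjoin K ({e, s * e * s} : Set (Module.End K M)) := by
  set A := Algebra.adjoin K ({e, s * e * s} : Set (Module.End K M))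
  have he : e ∈ A := Algebra.subset_adjoin (Set.mem_insert _ _)
  have hN : s * e * s ∈ A := Algebra.subset_adjoin (Set.mem_insert_of_mem _ rfl)
  refine Subalgebra.sum_mem _ fun i _ ↦ Subalgebra.sum_mem _ fun t _ ↦ Subalgebra.smul_mem _ ?_ _
  refine Subalgebra.mul_mem _ (Subalgebra.sub_mem _ ?_ ?_) (Subalgebra.sub_mem _ ?_ ?_)
  · exact Subalgebra.mul_mem _ (Subalgebra.pow_mem _ he _) (Subalgebra.pow_mem _ hN _)
  · exact Subalgebra.mul_mem _ (Subalgebra.pow_mem _ he _) (Subalgebra.pow_mem _ hN _)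
  · exact Subalgebra.mul_mem _ (Subalgebra.pow_mem _ hN _) (Subalgebra.pow_mem _ he _)
  · exact Subalgebra.mul_mem _ (Subalgebra.pow_mem _ hN _) (Subalgebra.pow_mem _ he _)

/-- **`W` on a string: `W (eʲ p) = (−1)^{(d−k)(d−k+1)/2} (j!/(k−j)!) · eʲ p`** for `p ∈ P_{-k}`, `k ≤ D`, `j ≤ k`.
[cite: Andre1996Motifs, §1.1 (p. 10)] -/
theorem IsStringReversal.andreWeight_apply_pow_primitive {s : Module.End K M} (hs : IsStringReversal h e s) (d : ℕ)
    {D k : ℕ} (hkD : k ≤ D) {p : M} (hp : p ∈ primitiveSpace h e k) {j : ℕ} (hj : j ≤ k) :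
    andreWeight e s d D ((e ^ j) p) =
      ((-1 : K) ^ ((d - k) * (d - k + 1) / 2) * ((j ! : ℕ) : K) * (((k - j) ! : ℕ) : K)⁻¹) • (e ^ j) p := by
  have hterm : ∀ i t : ℕ,
      (((-1 : K) ^ ((d - (i + t)) * (d - (i + t) + 1) / 2) * ((i ! : ℕ) : K) * ((t ! : ℕ) : K)⁻¹) •
        ((e ^ i * (s * e * s) ^ i - e ^ (i + 1) * (s * e * s) ^ (i + 1)) *
          ((s * e * s) ^ t * e ^ t - (s * e * s) ^ (t + 1) * e ^ (t + 1)))) ((e ^ j) p) =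
        if i = j ∧ j + t = k then
          ((-1 : K) ^ ((d - (i + t)) * (d - (i + t) + 1) / 2) * ((i ! : ℕ) : K) * ((t ! : ℕ) : K)⁻¹) • (e ^ j) p
        else 0 := by
    intro i t
    rw [LinearMap.smul_apply, Module.End.mul_apply, hs.coposProj_apply hp t j]
    by_cases hjt : j + t = k
    · rw [if_pos hjt, hs.posProj_apply hp i hj]
      by_cases hij : i = j
      · rw [if_pos hij, if_pos ⟨hij, hjt⟩]
      · rw [if_neg hij, smul_zero, if_neg (fun h' ↦ hij h'.1)]
    · rw [if_neg hjt, map_zero, smul_zero, if_neg (fun h' ↦ hjt h'.2)]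
  rw [andreWeight, LinearMap.sum_apply]
  simp_rw [LinearMap.sum_apply, hterm]
  rw [Finset.sum_eq_single j, Finset.sum_eq_single (k - j)]
  · rw [if_pos ⟨rfl, by omega⟩, show j + (k - j) = k by omega]
  · intro t _ ht
    rw [if_neg (fun h' ↦ ht (by omega))]
  · intro hkj
    exact absurd (Finset.mem_range.2 (by omega)) hkj
  · intro i _ hi
    refine Finset.sum_eq_zero fun t _ ↦ ?_
    rw [if_neg (fun h' ↦ hi h'.1)]
  · intro hjD
    exact absurd (Finset.mem_range.2 (by omega)) hjD

namespace HasLefschetzProperty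

variable [CharZero K] [FiniteDimensional K M]

/-- **André's Hodge involution `*_H`** ("`*_H x = Σ (−1)^{(j−2k)(j−2k+1)/2} (k!/(d−j+k)!) L^{d−j+k} x_{j−2k}`"): `*_H = *_L ∘ W`, the
constructed Lefschetz involution of the tree followed by André's weight `W = andreWeight e *_L d (dim M)` — on a Lefschetz component
`Lᵏ x_i` (`x_i` primitive of degree `i`, at position `k` of a string of co-length `d − i`) the sign `(−1)^{i(i+1)/2}` and the factor
`k!/(d−i−k)!`.  NOT the tree's `hodgeInvolution` (= Kleiman's `⋆`, Milne's `∗`: no factor), see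
`andreHodgeInvolution_apply_pow_primitive_eq_smul_hodgeInvolution`. [cite: Andre1996Motifs, §1.1 (p. 10, "involutions de Lefschetz et de Hodge")] -/
def andreHodgeInvolution (L : HasLefschetzProperty h e) (hgr : IsZGrading h) (d : ℕ) : Module.End K M :=
  L.lefschetzInvolution hgr * andreWeight e (L.lefschetzInvolution hgr) d (Module.finrank K M)

/-- **THE PRINTED FORMULA on a string: `*_H (eʲ p) = (−1)^{(d−k)(d−k+1)/2} (j!/(k−j)!) · e^{k−j} p`** for `p ∈ P_{-k}`, `j ≤ k`
(André's `*_H (Lʲ x_i) = (−1)^{i(i+1)/2} (j!/(d−i−j)!) L^{d−i−j} x_i`, `i = d − k`). [cite: Andre1996Motifs, §1.1 (p. 10)] -/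
theorem andreHodgeInvolution_apply_pow_primitive (L : HasLefschetzProperty h e) (hgr : IsZGrading h) (d : ℕ) {k : ℕ} {p : M}
    (hp : p ∈ primitiveSpace h e k) {j : ℕ} (hj : j ≤ k) :
    L.andreHodgeInvolution hgr d ((e ^ j) p) =
      ((-1 : K) ^ ((d - k) * (d - k + 1) / 2) * ((j ! : ℕ) : K) * (((k - j) ! : ℕ) : K)⁻¹) • (e ^ (k - j)) p := by
  by_cases hk : Module.finrank K M ≤ k
  · rw [L.eq_zero_of_mem_primitiveSpace_of_finrank_le hk hp, map_zero, map_zero, map_zero, smul_zero]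
  rw [andreHodgeInvolution, Module.End.mul_apply,
    (L.isStringReversal_lefschetzInvolution hgr).andreWeight_apply_pow_primitive d (le_of_lt (not_le.1 hk)) hp hj, map_smul,
    L.isStringReversal_lefschetzInvolution hgr hp hj]

/-- On a primitive vector: `*_H p = ((−1)^{(d−k)(d−k+1)/2} / k!) · eᵏ p` (`*_H x_i = (−1)^{i(i+1)/2} L^{d−i} x_i / (d−i)!`).
[cite: Andre1996Motifs, §1.1 (p. 10)] -/
theorem andreHodgeInvolution_apply_primitive (L : HasLefschetzProperty h e) (hgr : IsZGrading h) (d : ℕ) {k : ℕ} {p : M}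
    (hp : p ∈ primitiveSpace h e k) :
    L.andreHodgeInvolution hgr d p = ((-1 : K) ^ ((d - k) * (d - k + 1) / 2) * ((k ! : ℕ) : K)⁻¹) • (e ^ k) p := by
  have h1 := L.andreHodgeInvolution_apply_pow_primitive hgr d hp (Nat.zero_le k) (j := 0)
  rwa [pow_zero, Module.End.one_apply, Nat.sub_zero, Nat.factorial_zero, Nat.cast_one, mul_one] at h1

/-- **`*_H = (j!/(k−j)!) · ⋆` on `eʲ p`**: André's involution is Kleiman's `⋆` / Milne's `∗` (the tree's `hodgeInvolution`) rescaled
on each Lefschetz component. [cite: Andre1996Motifs, §1.1 (p. 10)] [cite: Kleiman1968AlgebraicCycles, §1.4, 1.4.2] [cite: Milne1999LefschetzClasses, §5 p. 664] -/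
theorem andreHodgeInvolution_apply_pow_primitive_eq_smul_hodgeInvolution (L : HasLefschetzProperty h e) (hgr : IsZGrading h)
    (d : ℕ) {k : ℕ} {p : M} (hp : p ∈ primitiveSpace h e k) {j : ℕ} (hj : j ≤ k) :
    L.andreHodgeInvolution hgr d ((e ^ j) p) =
      (((j ! : ℕ) : K) * (((k - j) ! : ℕ) : K)⁻¹) • L.hodgeInvolution hgr d ((e ^ j) p) := by
  rw [L.andreHodgeInvolution_apply_pow_primitive hgr d hp hj, L.hodgeInvolution_apply_pow_primitive hgr d hp hj, smul_smul]
  congr 1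
  ring

/-- **`*_H` is an involution: `*_H ∘ *_H = 1`** (on `eʲ p`: the factors `j!/(k−j)!` and `(k−j)!/j!` cancel).
[cite: Andre1996Motifs, §1.1 (p. 10, "involutions de Lefschetz et de Hodge")] -/
theorem andreHodgeInvolution_mul_self (L : HasLefschetzProperty h e) (hgr : IsZGrading h) (d : ℕ) :
    L.andreHodgeInvolution hgr d * L.andreHodgeInvolution hgr d = 1 := by
  refine L.linearMap_ext_of_strings hgr fun k p hp j hj ↦ ?_
  rw [Module.End.mul_apply, Module.End.one_apply, L.andreHodgeInvolution_apply_pow_primitive hgr d hp hj, map_smul,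
    L.andreHodgeInvolution_apply_pow_primitive hgr d hp (Nat.sub_le k j), smul_smul, show k - (k - j) = j by omega]
  have h1 : (((k - j) ! : ℕ) : K) ≠ 0 := factorial_ne_zero _
  have h2 : ((j ! : ℕ) : K) ≠ 0 := factorial_ne_zero _
  calc ((-1 : K) ^ ((d - k) * (d - k + 1) / 2) * ((j ! : ℕ) : K) * (((k - j) ! : ℕ) : K)⁻¹ *
        ((-1 : K) ^ ((d - k) * (d - k + 1) / 2) * (((k - j) ! : ℕ) : K) * ((j ! : ℕ) : K)⁻¹)) • (e ^ j) p
      = (((-1 : K) ^ ((d - k) * (d - k + 1) / 2) * (-1 : K) ^ ((d - k) * (d - k + 1) / 2)) *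
          ((((j ! : ℕ) : K) * ((j ! : ℕ) : K)⁻¹) * ((((k - j) ! : ℕ) : K)⁻¹ * (((k - j) ! : ℕ) : K)))) • (e ^ j) p := by
        congr 1; ring
    _ = (e ^ j) p := by rw [neg_one_pow_mul_self, mul_inv_cancel₀ h2, inv_mul_cancel₀ h1, mul_one, mul_one, one_smul]

/-- `*_H (*_H x) = x`. [cite: Andre1996Motifs, §1.1 (p. 10)] -/
theorem andreHodgeInvolution_andreHodgeInvolution (L : HasLefschetzProperty h e) (hgr : IsZGrading h) (d : ℕ) (x : M) :
    L.andreHodgeInvolution hgr d (L.andreHodgeInvolution hgr d x) = x := by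
  rw [← Module.End.mul_apply, L.andreHodgeInvolution_mul_self hgr d, Module.End.one_apply]

/-- The factors of `*_H L *_H` on `e^{i+1} p`: `((i+1)!/(k−i−1)!) · ((k−i)!/i!) = (i+1)(k−i)` — the coefficient of `ᶜΛ`. [folklore] -/
private theorem andre_coeff_mul {k i : ℕ} (hik : i + 1 ≤ k) :
    (((i + 1) ! : ℕ) : K) * (((k - (i + 1)) ! : ℕ) : K)⁻¹ * ((((k - i) ! : ℕ) : K) * ((i ! : ℕ) : K)⁻¹) =
      ((((i : ℤ) + 1) * ((k : ℤ) - i) : ℤ) : K) := by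
  obtain ⟨m, rfl⟩ : ∃ m, k = i + 1 + m := ⟨k - (i + 1), by omega⟩
  rw [show i + 1 + m - (i + 1) = m by omega, show i + 1 + m - i = m + 1 by omega, Nat.factorial_succ i, Nat.factorial_succ m]
  have h1 : ((m ! : ℕ) : K) ≠ 0 := factorial_ne_zero _
  have h2 : ((i ! : ℕ) : K) ≠ 0 := factorial_ne_zero _
  push_cast
  field_simp
  ring

/-- **`*_H L *_H = ᶜΛ` ON THE NOSE** — the normalisation by `k!/(d−j+k)!` is exactly the one that conjugates `L` into André's
abstract Hodge operator `ᶜΛ x = Σ k(d−j+k+1) L^{k−1} x_{j−2k}` (on `eʲ p`: `(j!/(k−j)!)((k−j+1)!/(j−1)!) = j(k−j+1)`), whereas the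
factorial-free `⋆` only gives `⋆ L ⋆ = *_L L *_L = ᶜL`, "proportionnel à `ᶜΛ` sur chaque composante de Lefschetz".
[cite: Andre1996Motifs, §1.1 (p. 10–11, formulas for ᶜΛ and *_H; "ᶜL = *_L L *_L, proportionnel à ᶜΛ")] [cite: Kleiman1968AlgebraicCycles, §1.4, 1.4.6] -/
theorem andreHodgeInvolution_mul_e_mul_andreHodgeInvolution (L : HasLefschetzProperty h e) (hgr : IsZGrading h) (d : ℕ) :
    L.andreHodgeInvolution hgr d * e * L.andreHodgeInvolution hgr d = L.dual hgr := by
  refine L.linearMap_ext_of_strings hgr fun k p hp j hj ↦ ?_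
  rw [Module.End.mul_apply, Module.End.mul_apply, L.andreHodgeInvolution_apply_pow_primitive hgr d hp hj, map_smul, map_smul,
    ← Module.End.mul_apply e (e ^ (k - j)), ← pow_succ']
  cases j with
  | zero =>
    rw [Nat.sub_zero, (mem_primitiveSpace_iff.1 hp).2, map_zero, smul_zero, pow_zero, Module.End.one_apply,
      L.dual_apply_primitive hgr hp]
  | succ i =>
    rw [show k - (i + 1) + 1 = k - i by omega, L.andreHodgeInvolution_apply_pow_primitive hgr d hp (show k - i ≤ k by omega),
      smul_smul, show k - (k - i) = i by omega, L.dual_apply_pow_primitive hgr hp i]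
    congr 1
    rw [← andre_coeff_mul hj]
    calc (-1 : K) ^ ((d - k) * (d - k + 1) / 2) * (((i + 1) ! : ℕ) : K) * (((k - (i + 1)) ! : ℕ) : K)⁻¹ *
          ((-1 : K) ^ ((d - k) * (d - k + 1) / 2) * (((k - i) ! : ℕ) : K) * ((i ! : ℕ) : K)⁻¹)
        = ((-1 : K) ^ ((d - k) * (d - k + 1) / 2) * (-1 : K) ^ ((d - k) * (d - k + 1) / 2)) *
            ((((i + 1) ! : ℕ) : K) * (((k - (i + 1)) ! : ℕ) : K)⁻¹ * ((((k - i) ! : ℕ) : K) * ((i ! : ℕ) : K)⁻¹)) := by ring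
      _ = (((i + 1) ! : ℕ) : K) * (((k - (i + 1)) ! : ℕ) : K)⁻¹ * ((((k - i) ! : ℕ) : K) * ((i ! : ℕ) : K)⁻¹) := by
          rw [neg_one_pow_mul_self, one_mul]

/-- **`*_H` reverses the grading: `h *_H = −*_H h`.** [cite: Andre1996Motifs, §1.1 (p. 10)] -/
theorem mul_andreHodgeInvolution_eq_neg (L : HasLefschetzProperty h e) (hgr : IsZGrading h) (d : ℕ) :
    h * L.andreHodgeInvolution hgr d = -(L.andreHodgeInvolution hgr d * h) := by
  refine L.linearMap_ext_of_strings hgr fun k p hp j hj ↦ ?_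
  rw [Module.End.mul_apply, LinearMap.neg_apply, Module.End.mul_apply, L.apply_pow_primitive_eq_smul hp j, map_smul,
    L.andreHodgeInvolution_apply_pow_primitive hgr d hp hj, map_smul, L.apply_pow_primitive_eq_smul hp (k - j), smul_comm,
    ← neg_smul]
  congr 1
  rw [← Int.cast_neg]
  congr 1
  push_cast [Nat.cast_sub hj]
  ring

/-- `*_H` maps `M_m` into `M_{−m}` (`Hʲ → H^{2d−j}`). [cite: Andre1996Motifs, §1.1 (p. 10)] -/
theorem andreHodgeInvolution_apply_mem (L : HasLefschetzProperty h e) (hgr : IsZGrading h) (d : ℕ) {m : ℤ} {x : M}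
    (hx : x ∈ degreeSpace h m) : L.andreHodgeInvolution hgr d x ∈ degreeSpace h (-m) := by
  rw [mem_degreeSpace_iff] at hx ⊢
  have h1 := LinearMap.congr_fun (L.mul_andreHodgeInvolution_eq_neg hgr d) x
  rw [Module.End.mul_apply, LinearMap.neg_apply, Module.End.mul_apply, hx, map_smul] at h1
  rw [h1, Int.cast_neg, neg_smul]

omit [FiniteDimensional K M] in
/-- **`*_H ∈ K[L, *_L]`** ("`ℚ[L, *_H] ⊆ ℚ[L, *_L]`"). [cite: Andre1996Motifs, Prop. 1.2 (p. 11)] -/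
theorem andreHodgeInvolution_mem_adjoin (L : HasLefschetzProperty h e) (hgr : IsZGrading h) (d : ℕ) :
    L.andreHodgeInvolution hgr d ∈ Algebra.adjoin K ({e, L.lefschetzInvolution hgr} : Set (Module.End K M)) := by
  have hs : L.lefschetzInvolution hgr ∈ Algebra.adjoin K ({e, L.lefschetzInvolution hgr} : Set (Module.End K M)) :=
    Algebra.subset_adjoin (Set.mem_insert_of_mem _ rfl)
  have he : e ∈ Algebra.adjoin K ({e, L.lefschetzInvolution hgr} : Set (Module.End K M)) :=
    Algebra.subset_adjoin (Set.mem_insert _ _)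
  refine Subalgebra.mul_mem _ hs (Algebra.adjoin_le ?_ (andreWeight_mem_adjoin _ d _))
  rintro x (rfl | rfl)
  · exact he
  · exact Subalgebra.mul_mem _ (Subalgebra.mul_mem _ hs he) hs

/-- **`*_H ∈ K[L, ᶜΛ]`** (`K[L, *_L] = K[L, ᶜΛ]`, Kleiman 1.4.5 in `LefschetzModuleKleimanAlgebra`). [cite: Andre1996Motifs, Prop. 1.2 (p. 11)] -/
theorem andreHodgeInvolution_mem_adjoin_pair_dual (L : HasLefschetzProperty h e) (hgr : IsZGrading h) (d : ℕ) :
    L.andreHodgeInvolution hgr d ∈ Algebra.adjoin K ({e, L.dual hgr} : Set (Module.End K M)) := by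
  rw [← L.adjoin_pair_lefschetzInvolution_eq_adjoin_pair_dual hgr]
  exact L.andreHodgeInvolution_mem_adjoin hgr d

/-- **André's Prop. 1.2 for his own `*_H`: `K[L, *_H] = K[L, ᶜΛ]`** (`⊆`: the previous theorem; `⊇`: `ᶜΛ = *_H L *_H`).
[cite: Andre1996Motifs, Prop. 1.2 (p. 11: "Les sous-algèbres ℚ[L, *_L], ℚ[L, *_H], ℚ[L, ᶜL], ℚ[L, ᶜΛ] de End H*(X) sont égales")] -/
theorem adjoin_pair_andreHodgeInvolution_eq_adjoin_pair_dual (L : HasLefschetzProperty h e) (hgr : IsZGrading h) (d : ℕ) :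
    Algebra.adjoin K ({e, L.andreHodgeInvolution hgr d} : Set (Module.End K M)) =
      Algebra.adjoin K ({e, L.dual hgr} : Set (Module.End K M)) := by
  refine le_antisymm (Algebra.adjoin_le ?_) (Algebra.adjoin_le ?_)
  · rintro x (rfl | rfl)
    · exact Algebra.subset_adjoin (Set.mem_insert _ _)
    · exact L.andreHodgeInvolution_mem_adjoin_pair_dual hgr d
  · rintro x (rfl | rfl)
    · exact Algebra.subset_adjoin (Set.mem_insert _ _)
    · have hA : L.andreHodgeInvolution hgr d ∈ Algebra.adjoin K ({e, L.andreHodgeInvolution hgr d} : Set (Module.End K M)) :=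
        Algebra.subset_adjoin (Set.mem_insert_of_mem _ rfl)
      have he : e ∈ Algebra.adjoin K ({e, L.andreHodgeInvolution hgr d} : Set (Module.End K M)) :=
        Algebra.subset_adjoin (Set.mem_insert _ _)
      rw [SetLike.mem_coe, ← L.andreHodgeInvolution_mul_e_mul_andreHodgeInvolution hgr d]
      exact Subalgebra.mul_mem _ (Subalgebra.mul_mem _ hA he) hA

omit [FiniteDimensional K M] in
/-- An operator commuting with `h` and `e` commutes with `*_H` (it commutes with `*_L`, hence with `K[L, *_L] ∋ *_H`).
[cite: Milne1999LefschetzClasses, §5 Thm. 5.9 (proof, p. 665)] [cite: Andre1996Motifs, Prop. 1.2 (p. 11)] -/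
theorem commute_andreHodgeInvolution (L : HasLefschetzProperty h e) (hgr : IsZGrading h) (d : ℕ) {u : Module.End K M}
    (huh : Commute u h) (hue : Commute u e) : Commute u (L.andreHodgeInvolution hgr d) :=
  commute_of_mem_adjoin_pair hue (L.commute_lefschetzInvolution hgr huh hue) (L.andreHodgeInvolution_mem_adjoin hgr d)

/-! ### §4 "l'élément `(0 1 ; −1 0)` de `SL₂` s'envoie sur `± *_H`": `*_H = (−1)^{d + n(n−1)/2} w` on `Hⁿ` -/

/-- **`*_H (eʲ p) = (−1)^{(d−k)(d−k+1)/2 + k + j} · w (eʲ p)`**: on every string vector André's involution is `±` the Weyl operator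
(both are `(j!/(k−j)!) e^{k−j} p` up to sign). [cite: Andre1996Motifs, §1.2 (p. 11, "(0 1 ; −1 0) de SL₂ s'envoie sur ± *_H")] -/
theorem andreHodgeInvolution_apply_pow_primitive_eq_smul_weylOperator (L : HasLefschetzProperty h e) (hgr : IsZGrading h)
    (d : ℕ) {k : ℕ} {p : M} (hp : p ∈ primitiveSpace h e k) {j : ℕ} (hj : j ≤ k) :
    L.andreHodgeInvolution hgr d ((e ^ j) p) =
      ((-1 : K) ^ ((d - k) * (d - k + 1) / 2 + (k + j))) • L.weylOperator hgr ((e ^ j) p) := by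
  rw [L.andreHodgeInvolution_apply_pow_primitive hgr d hp hj, L.weylOperator_apply_pow_primitive hgr hp hj, smul_smul]
  congr 1
  rw [pow_add]
  calc (-1 : K) ^ ((d - k) * (d - k + 1) / 2) * ((j ! : ℕ) : K) * (((k - j) ! : ℕ) : K)⁻¹
      = (-1 : K) ^ ((d - k) * (d - k + 1) / 2) * ((-1 : K) ^ (k + j) * (-1 : K) ^ (k + j)) *
          ((j ! : ℕ) : K) * (((k - j) ! : ℕ) : K)⁻¹ := by rw [neg_one_pow_mul_self, mul_one]
    _ = (-1 : K) ^ ((d - k) * (d - k + 1) / 2) * (-1) ^ (k + j) *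
          ((-1 : K) ^ (k + j) * ((j ! : ℕ) : K) * (((k - j) ! : ℕ) : K)⁻¹) := by ring

omit [FiniteDimensional K M] in
omit [CharZero K] [FiniteDimensional K M] in
/-- The sign depends on the degree only: with `i = d − k` (the degree of the primitive class) and `n = i + 2j` (the degree of
`eʲ p`), `(−1)^{i(i+1)/2 + k + j} = (−1)^{d + n(n−1)/2}` — here with `i(i+1)/2 = C(i+1, 2)`, `n(n−1)/2 = C(n, 2)`; by induction on
`j` (`C(n+2, 2) = C(n, 2) + 2n + 1`). [cite: Andre1996Motifs, §1.2 (p. 11, "le signe étant … sur la composante Hʲ")] -/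
theorem neg_one_pow_choose_succ_add (i k j : ℕ) :
    (-1 : K) ^ ((i + 1).choose 2 + (k + j)) = (-1 : K) ^ (i + k + (i + 2 * j).choose 2) := by
  induction j with
  | zero =>
    rw [choose_two_succ, mul_zero, add_zero, add_zero]
    congr 1
    omega
  | succ j ih =>
    have h1 : (i + 2 * (j + 1)).choose 2 = (i + 2 * j).choose 2 + 2 * (i + 2 * j) + 1 := by
      rw [show i + 2 * (j + 1) = (i + 2 * j + 1) + 1 by ring, choose_two_succ, choose_two_succ]
      ring
    rw [h1, show (i + 1).choose 2 + (k + (j + 1)) = ((i + 1).choose 2 + (k + j)) + 1 by ring, pow_succ, ih,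
      show i + k + ((i + 2 * j).choose 2 + 2 * (i + 2 * j) + 1) = (i + k + (i + 2 * j).choose 2) + 2 * (i + 2 * j) + 1 by ring,
      pow_succ (-1 : K) (i + k + (i + 2 * j).choose 2 + 2 * (i + 2 * j)),
      pow_add (-1 : K) (i + k + (i + 2 * j).choose 2) (2 * (i + 2 * j)), pow_mul, neg_one_sq, one_pow, mul_one]

/-- **"l'élément `(0 1 ; −1 0)` de `SL₂` s'envoie sur `± *_H`, le signe [ne dépendant que de] la composante `Hʲ`":
`*_H x = (−1)^{d + n(n−1)/2} · w x` for every `x ∈ Hⁿ(X) = M_{n−d}`** (`n(n−1)/2 = C(n, 2)`, `Nat.choose_two_right`), provided all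
strings have co-length `≤ d` (`depth ≤ d`, automatic for `H*(X)`, `d = dim X`). [cite: Andre1996Motifs, §1.2 (p. 11)] -/
theorem andreHodgeInvolution_apply_of_mem_degreeSpace (L : HasLefschetzProperty h e) (hgr : IsZGrading h) {d : ℕ}
    (hd : depth h ≤ d) {m : ℤ} {n : ℕ} (hn : (n : ℤ) = m + d) {x : M} (hx : x ∈ degreeSpace h m) :
    L.andreHodgeInvolution hgr d x = ((-1 : K) ^ (d + n.choose 2)) • L.weylOperator hgr x := by
  have h1 := L.eq_zero_of_forall_string_of_mem_degreeSpace hgr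
    (T := L.andreHodgeInvolution hgr d - ((-1 : K) ^ (d + n.choose 2)) • L.weylOperator hgr) (m := m) ?_ hx
  · rwa [LinearMap.sub_apply, LinearMap.smul_apply, sub_eq_zero] at h1
  intro k p hp j hj hkm
  rw [LinearMap.sub_apply, LinearMap.smul_apply, sub_eq_zero,
    L.andreHodgeInvolution_apply_pow_primitive_eq_smul_weylOperator hgr d hp hj]
  by_cases hp0 : p = 0
  · rw [hp0, map_zero, map_zero, smul_zero, smul_zero]
  have hkd : k ≤ d := by
    refine le_trans ?_ hd
    by_contra hlt
    have hbot := L.degreeSpace_neg_eq_bot_of_depth_lt (not_le.1 hlt)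
    have hpk := (mem_primitiveSpace_iff.1 hp).1
    rw [hbot, Submodule.mem_bot] at hpk
    exact hp0 hpk
  congr 1
  have h2 : (d - k) * (d - k + 1) / 2 = (d - k + 1).choose 2 := by
    rw [Nat.choose_two_right, Nat.add_sub_cancel, mul_comm]
  rw [h2, neg_one_pow_choose_succ_add (d - k) k j]
  congr 1
  have h3 : d - k + k = d := by omega
  have h4 : d - k + 2 * j = n := by omega
  rw [h3, h4]

end HasLefschetzProperty

end Literature.Algebra.Lie
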